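import Mathlib
import HarnessLib
import HarnessLib.Audit
import Summits.Ventures.HodgeKum4.Statement
import Summits.Ventures.HodgeKum4.Theorems.KummerFixedLocusDefs
import Summits.Ventures.HodgeKum4.Theorems.KummerFixedLocusL1Defs
import Literature.AlgebraicGeometry.Hyperkaehler.LLVStructureKummerType
import Summits.Ventures.HodgeKum4.Theorems.LaneVDefs
import Literature.AlgebraicGeometry.Hyperkaehler.IrreducibleSymplecticOfDeformationType
import Literature.AlgebraicGeometry.HilbertScheme.HilbertSchemeTranslationAction
import Literature.AlgebraicGeometry.Hyperkaehler.GeneralizedKummerAutFixingH2H3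
import Literature.AlgebraicGeometry.Hyperkaehler.GeneralizedKummerFourTranslationFixedPoints
import Summits.Ventures.HodgeKum4.Theorems.KummerFixedLocusLefschetzGenerationKum4Glue

/-!
Route: KummerFixedLocus

DORMANT since 2026-09-01T16:19:17Z (reconciler: no traction for 5 d (last activity item-evidence-added at 2026-08-27T15:40:30Z); parked, not closed — `ledger route dormant route-Ventures-KummerFixedLocus --off` to reactivate) — unstaffed, not closed; items shared with open routes are served there. `ledger route dormant <id> --off` reactivates.

# Route KummerFixedLocus — Hodge conjecture for Kum⁴-type eightfolds via Γ-invariant LLV generation,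
motivic domination by J³, and fixed-fourfold classes

Rung H3 of the HodgeAV ladder (cell hodge-kum4): the Hodge conjecture for every smooth projective
eightfold X of
generalized-Kummer deformation type Kum⁴ — the LEAF `Summit.Ventures.HodgeKum4.HC_Kum4Type` below
the summit (alt closer,
class rung; never summit credit). It suffices to show X = L1 ∧ L3° ∧ L2 ∧ (F_Γ ∧ F_Γ′, print
inputs): (L1) for every sl₂-triple (L_ℓ, h, Λ) of X the
Γ(X)-invariant cohomology lies in the cup-and-Λ closure of H⁰ ⊕ H² ⊕ H³, Γ(X) = automorphisms acting
trivially on H² ⊕ H³;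
(L2) given L1, every Γ(X)-invariant rational (p,p)-class is algebraic (motivic domination of h(X)^Γ
by powers of the
discriminant-one Weil fourfold J³(X)); (L3-inputs) |Γ(X)| = 625 with the non-invariant part of H⁸ of
dimension ≤ 624 and Γ
trivial off degree 8 (print), and the coinvariant kernel of H⁸ spanned by classes of the 625 fixed
fourfolds (cell). Averaging
over the finite group Γ(X) splits any rational (p,p)-class into an invariant one (L2) plus a
coinvariant-kernel one (L3°).
Lean: `Summit.Ventures.HodgeKum4.LefschetzGenerationKum4 ∧
Summit.Ventures.HodgeKum4.Kum4NonInvariantClassesAlgebraic ∧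
Summit.Ventures.HodgeKum4.MotivicBookkeepingKum4 ∧ Summit.Ventures.HodgeKum4.Kum4TranslationGroup ∧
Summit.Ventures.HodgeKum4.Kum4TranslationGroupTrivialOffMiddle`

## Assembly
Finite-group averaging (kernel, module `Summits/Ventures/HodgeKum4/Statement.lean`):
Kum4TranslationGroup gives `Finite Γ(X)`; for a rational (p,p)-class c
the average c₀ = |Γ|⁻¹ Σ γ·c is rational, (p,p) and Γ-invariant, hence algebraic by
MotivicBookkeepingKum4 applied to LefschetzGenerationKum4; c − c₀ =
|Γ|⁻¹ Σ (c − γ·c) lies in the coinvariant kernel, algebraic in degree 8 by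
Kum4NonInvariantClassesAlgebraic and zero in degrees ≠ 8 by
Kum4TranslationGroupTrivialOffMiddle; c = c₀ + (c − c₀). Deciding theorem (glue.lean v2.2) `closes
:= (show Assembly from fun a b c d e =>
Summit.Ventures.HodgeKum4.hc_kum4Type_of_inputs a c d e b) h₁ h₃ h₂ hΓ hoff` — the five crux binders
are fed through the schema's single assembly item
below, so that EVERY declared item (5 cruxes + Assembly) lies in the cone of `closes` (BC6; tagged
simulated rendering sim_crux_v22A.lean: lean check
rc 0, `#h21_check_closes` ok, codes [], conclusion `Summit.Ventures.HodgeKum4.HC_Kum4Type`, 5/5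
binders used, in_cone 6/6, axioms propext /
Classical.choice / Quot.sound; with the v2.1 term `hc_kum4Type_of_inputs h₁ h₂ hΓ hoff h₃` in_cone
was 5/6, Assembly outside).
`Summit.Ventures.HodgeKum4.assembly_holds` proves the assembly item in the Statement module (closes
by transcription).

CLOSES_TARGET: closes rung H3 of Ventures/HodgeKum4: Summit.Ventures.HodgeKum4.HC_Kum4Type (D-0061; not the summit Statement) — the deciding theorem of this route concludes that registered leaf (Ventures/HodgeKum4: no summit Statement) (class rung: servable and labelled, never counted as concluding the summit Statement).

Rationale: WHY THIS LINE. Mechanism: split H*(X;ℚ) under the finite group Γ(X) ≅ (ℤ/5)⁴ (BNWS arXiv:1001.4728,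
HassettTschinkel2010, Oguiso arXiv:1208.3750, Foster2024 Rmk 88). On the invariant side the
Looijenga–Lunts–Verbitsky algebra so(4, b₂−2) (LooijengaLunts1997, GreenKimLazaRobles2022 Thm 14/Cor
32) together with H³ generates everything (L1; since rev 20 routed through LANE (V): H*(A^[5]) is
generated from H^{≤3} by cup product and the transferred dual Lefschetz operator in the
Nakajima–Li–Qin–Wang Fock space (LiQinWang2002, Lehn1999, Oberdieck2021; computed-certified at n = 5
in all degrees), transferred to K⁴(A) ⊂ A^[5] along Beauville's Galois cover (V0) and to every X by
Hassett–Tschinkel transport (T₄); the Fantechi–Göttsche orbifold model MODEL_X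
(FantechiGoettsche2003 Thm 3.10, FuTianVial2019) is the banked alternative), so h(X)^Γ is dominated
by powers of J³(X) through algebraic correspondences (Markman2023GeneralizedKummers Thm 1.4: h³(X) ≅
h¹(J³X)(−1); Voisin2022FootnotesOGradyMarkman Thm 4.1 KSHC with OGrady2021KummerTori Thm 1.5: H²
reached from J³(X)⁴; Foster2024 Cor 2: Λ algebraic), and HC for all powers of a discriminant-one
Weil fourfold is a theorem (Floccari2026 Thm 5.12, FloccariFu2026), whence Arapura2006 Lem 4.2 (tree
fact) or the retract bookkeeping gives L2. On the non-invariant side the 624-dimensional complement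
in H⁸ is spanned by differences of classes of the 625 fixed fourfolds W_x = g·W₀ (g ∈ Γ(X)), W₀ =
Fix(ι) ≅ (Kummer K3)^[2] (Floccari2026 Lem 4.2/Prop 4.6, KamenovaMongardiOblomkov2022): the Gram
matrix is 5·Id + J, from [W₀]² = 6 (g-signature, Hirzebruch1969SignatureRamifiedCoverings;
Hodge–Riemann in the middle) and [W₀]·[W_x] = 1, and the latter needs exactly ONE geometric input —
W₀ meets each translate g·W₀, g ≠ 1, in one reduced point (I1geo) — which the rigidity of the fixed
fourfolds under deformation (HassettTschinkel2013 + Floccari2026, refereed; Literature fact (T))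
transports from the classical generalized Kummer varieties K⁴(A), A an abelian surface, where Fix(g)
is 125 reduced points (Oguiso2020CohomologicallyTrivialKummer Prop 3.6) and the input becomes a
POINT COUNT: exactly one of those 125 points lies on W₀ (booking B″; crux of record
Kum4FixedPointCountAtKummer) — or, OF RECORD since rev 16 (bill A‴ «Route A on X»): ONE
print-synthesis input F125X «Fix(g) is 125 reduced points for EVERY X of Kum⁴-type, g ∈ Γ(X) ∖ 1»
(p451193; sources in the words at #3), giving I1geo on X directly. Imported areas: LLV
representation theory, Nakajima–Grojnowski/Li–Qin–Wang vertex-algebra structure of Hilbert schemes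
(lane V), motivated-cycle bookkeeping (André–Arapura), equivariant signature theory, finite group
actions on abelian surfaces. It decides a RUNG (Kum⁴), the first generalized-Kummer dimension with
HC open in print (Kum²: HassettTschinkel2010; Kum³: FloccariVaresco2024/Floccari2026), and reduces
the non-invariant half to a point count on classical varieties.

RANKED CRUXES. #2 LefschetzGenerationKum4 (crux) — for every smooth projective X of Kum⁴-type and
every sl₂-triple (L_ℓ, h, Λ), the Γ(X)-invariant classes lie in `opCupSpan Λ (degreeClasses
{0,2,3})` (cell lemma L1; COMPUTED-CERT ×2). REV 20 = LANE (V) (director-hodge g7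
2026-08-27T07:22:44Z/07:47:55Z, shape (α) of J's pre-read e04f3ef14233df2b; planner g16): `closes`
unchanged; L1's REGISTERED LINE `Cruxes/LefschetzGenerationKum4/Lines/laneV.lean` (5 stubs,
composition `LefschetzGenerationKum4_of` kernel-checked = the feeder
`lefschetzGenerationKum4_of_laneV`) and its name-matched top-level items: LefschetzGenerationHilb5
(crux r2 — L1-Hilb(5): for every abelian surface A, full choice of Hilbert schemes with Li–Qin–Wang
Chern character operators, even Casimir tensor and Lefschetz class α of A, H*(A^[5](ℂ);ℂ) is
generated from H⁰⊕H¹⊕H²⊕H³ by cup product and f_α = T(Λ_A)|₅ —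
`Summit.Ventures.HodgeKum4.LefschetzGenerationHilb 5`, Theorems/LaneVDefs.lean (v0typer g0); D3 =
Literature THEOREM `ChernCharacterOperators.isDualLefschetz_transferOp` (p508760); EVIDENCE not
input: `Literature.Computation.AbelianHilbFock.fullClosure5` (n = 5, all degrees), `allN10_d8` (all
n, d ≤ 8), `lieCertificate`, P1/P2 n ≤ 6 ×2; all-n plan = V2 skeleton) · HilbertKummerTransfer (crux
r3 — V0: L1-Hilb at (A^[n+1], Λ_H) ⇔ L1 in range form on the Kummer fibre θ : K → A^[n+1]; first
target F6 `HilbertScheme.HilbertSchemeTranslationAction` (p510750/p511282), T3 plan-only) ·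
KummerRangeEqInvariants (support — im θ* = H*(K)^{Γ(K)}, n ≥ 2; KapferMenet2018 L5.4 + BNWS Cor
3.3(2); transfer step in tree); line-level, without items: seam S3 (stub: θ*D_α has a dual Lefschetz
operator on K for α a polarization; Beauville1983 §7 Prop 8 + LooijengaLunts1997 (4.5)–(4.7)); seams
S1 (every Kⁿ(A) is a Kummer fibre of a FULL choice of Hilbert schemes) and S2 (even Casimir tensor)
PROVED in the line from the Grothendieck–Fogarty fact (p514830) resp. the theorem
`exists_isCasimir_mem_evenTensorSpan` (p513175); and `stub_print` = the five named facts
`HilbertScheme.Fogarty1968_hilbertScheme_surface` (S1's input), T₄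
`Hyperkaehler.HassettTschinkel2013_autZero_cohomologyTransport_kumType` (p508652; PROVED consumer:
L1 at every K⁴(A) ⇒ L1 at every X), `LiQinWang2002_chernCharacterOperators`,
`Beauville1983_irreducibleSymplectic_of_kummerType` (b₁ = 0),
`LooijengaLuntsVerbitsky_llvStructure_kumType` (one triple ⇒ all). Gen-1 split (MODEL_X family) KEPT
AS RECORD, not refuted: KummerOrbifoldModelKum4 (19267; computed clause certified, 12 evidences) →
ASIDE, reactivable; KummerTranslationFrameExists (19268, print) open; FrameComplementKum4 (19458)
and glue 19304 CLOSED. So L1 is open on L1-Hilb(5) + V0 (+ print-backed bridge/seams). [difficulty: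
L] (why it might fail: L1-Hilb(5) is certified by finite Fock-engine computations whose operators
must still be IDENTIFIED with the typed cupOperator 0 / transferDual / boundary operator (LQW-W Thm
4.6, Oberdieck Cor 3.5) — a sign or normalisation invisible mod p would leave classes outside the
span; V0 needs Θ*Λ_HΘ*⁻¹ = Λ_K ⊗ 1 + 1 ⊗ Λ_A with sign-sensitive Künneth bookkeeping.)
[LiQinWang2002, LiQinWang2002W, Oberdieck2021, Lehn1999, Beauville1983, KapferMenet2018,
LooijengaLunts1997, GreenKimLazaRobles2022, Foster2024]
#3 Kum4NonInvariantClassesAlgebraic (crux) — L3°: for every smooth projective X of Kum⁴-type the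
kernel of H⁸(X;ℂ) → Γ(X)-coinvariants consists of algebraic classes. SPLIT (gen 2 = booking B″, k =
2; gen 1 retired 19278/19279/19280): Kum4TranslationGroupAndL1 (19503, support — conjunction of #5
and #2) · Kum4FixedPointCountAtKummer (19504, crux rank 302: on every K⁴(A)
(IsGeneralizedKummerVarietyOf 4 A K) with a Kummer fixed datum (ι₀, W₀, i₀), for every g ∈ Γ(K) ∖ 1
and every splitting of Fix(⟨g⟩) into 125 sections (Oguiso Prop 3.6), EXACTLY ONE of the 125 points
lies on W₀; `Summit.Ventures.HodgeKum4.Kum4FixedPointCountAtKummer`, @[conjecture],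
KummerFixedLocusDefs; BC7 CLEAN) + glue Kum4NonInvariantClassesAlgebraicGlue2 (19505, CLOSED MODULO
PRINT by `kum4NonInvariantClassesAlgebraic_pointCountGlue_of_facts`, eleven printed facts incl. (T)
as leading hypotheses). B″ chain: I1geo ⇐ (T) ⇐ I1geo at K⁴(A) ⇐ Oguiso's 125 points + |Γ| = 625 odd
+ the COUNT (kernel p428849); COUNT ⇐ print FV + (H2) (Γ transitive on Fix(g)(ℂ); DERIVED p442732
via p442214) + (H3) = crux #7, uniqueness by the odd-torsor lemma p431546, composed by p432727 —
REGISTERED LINE `Cruxes/Kum4FixedPointCountAtKummer/Lines/birth.lean` v4 (stubs FV · (H2) · #7):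
19504 and #7 closed modulo print in kernel (bill A′, rev 15). ROUTE A ON X (bill A‴, OF RECORD since
rev 16; seat p2): the same argument on an ARBITRARY X of Kum⁴-type from the single input F125X
closes the ORIGINAL residual I1geo `Kum4FixedFourfoldMeetsTranslates` and L3° itself modulo print —
`kum4FixedFourfoldMeetsTranslates_of_fixedPointsSplit` (p446589, --supports 19135) and the by-name
closer `hc_kum4Type_of_L1_of_split125` (p451323, --supports 19135). RUNG WORDS = director
2026-08-27T00:50:18Z words v6 (A4-BOOKING.md §6): (H3), (H2) and I1geo DERIVED on every X of
Kum⁴-type modulo refereed print plus ONE print-synthesis fact F125X (p451193; Oguiso 2020 Prop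
3.5–3.6 ⊕ HT13 Thm 2.1 ⊕ CGP A.8.10 ⊕ Floccari 2024 L2.2; REF-AUDIT-23 PASS; the gap to the
unrestricted-Kodaira-chain reading = Soldatenkov–Verbitsky 2024 Conj 1.2); André 1996 Prop 1.2
DISCHARGED in kernel (p468064); closer of record `hc_kum4Type_of_L1_of_split125'''` (p479571): 11
named Literature facts (10 REFEREED + F125X) + L1 ⇒ HC_Kum4Type ∧ HC_Kum4TypePowers; preprint NONE
load-bearing. Alternatives landed, not of record: A′ p442732, (T)-chain p430760; point model M1–M4
RETIRED (R12). [difficulty: M] (why it might fail: If some Kummer fixed datum (ι₀, W₀) on K⁴(A) is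
not Γ-conjugate to (−1, Floccari's W₀) — e.g. W₀ another 4-dimensional ι₀-fixed component on a
special A — the one-symmetric-coset count does not apply and W₀ could meet Fix(g) in 0 or 5 points.)
[Oguiso2020CohomologicallyTrivialKummer, Floccari2026, BoissiereNieperWisskirchenSarti2011,
KamenovaMongardiOblomkov2022, HassettTschinkel2013, Hirzebruch1969SignatureRamifiedCoverings,
Foster2024]
#4 MotivicBookkeepingKum4 (crux) — L1 → L2′: assuming LefschetzGenerationKum4, for every smooth
projective X of Kum⁴-type every rational (p,p)-class fixed by Γ(X) is algebraic (h(X)^Γ dominated by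
/ a retract of twisted powers of J³(X), whose powers satisfy HC). Conditional closer landed
(`motivicBookkeepingKum4_route_of_facts`, p430802); open on print by design. [deps:
LefschetzGenerationKum4] [difficulty: L] (why it might fail: H²(X) ⊆ correspondence-images from
powers of J³X needs KS(X,L) ~ J³(X)⁴ and KSHC(X) for EVERY polarised X (O'Grady Thm 1.5, Voisin Thm
4.1) — if only very general, CM members escape.) [Foster2024, Markman2023GeneralizedKummers,
Voisin2022FootnotesOGradyMarkman, OGrady2021KummerTori, Floccari2026, FloccariFu2026, Arapura2006]
#5 Kum4TranslationGroup (crux) — F_Γ (PRINT INPUT, REFEREED; crux-kind only because `closes` admits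
none but crux-kind binders (human ruling 2026-08-16); closes by transcription of the vendored facts
`Hyperkaehler.Floccari2026_card_autFixingH2H3_kum4Type` ∧
`Hyperkaehler.Foster2024_translationAction_kum4Type` via p2's definitional bridge; conditional
closers landed): for X smooth projective of Kum⁴-type, |Γ(X)| = 625 and every complement of the
Γ-invariants in H⁸(X;ℂ) has finrank ≤ 624. [difficulty: provable-now] (why it might fail: only by
misreading print — «≤ 624» is Foster Rmk 88 (J₄(5), GKLR Rmk 33; cf. NUMBERS); #Γ = 625 = #A[5]
transported along deformations (BNWS Cor 3.3(2); HT10 Thm 2.1 + Prop 3.1).) [Foster2024,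
Floccari2026, HassettTschinkel2010, arXiv:1001.4728, arXiv:1208.3750, GreenKimLazaRobles2022]
#6 Kum4TranslationGroupTrivialOffMiddle (crux) — F_Γ′ (PRINT INPUT, REFEREED; crux-kind for the same
gate reason; closes by transcription of `Hyperkaehler.Foster2024_translationAction_kum4Type`, 2nd
conjunct): Γ(X) acts trivially on Hᵏ(X;ℂ) for every k ≠ 8. [difficulty: provable-now] (why it might
fail: only by misreading print: below degree 8 it is Foster Rmk 88, above it needs Γ-equivariant
Poincaré duality — the vendored fact states both halves.) [Foster2024, HassettTschinkel2010,
FantechiGoettsche2003]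
#7 Kum4FixedFourfoldHasFixedPointAtKummer (crux) — (H3) THE ATOM OF THE RUNG (director R1
2026-08-26T08:09:37Z; stmt-Ventures-19595, @[conjecture]
`Summit.Ventures.HodgeKum4.Kum4FixedFourfoldHasFixedPointAtKummer` p431802; in-cone via 19504's
registered line; BC7 CLEAN): for every abelian surface A, every K with IsGeneralizedKummerVarietyOf
4 A K, every Kummer fixed datum (ι₀, W₀, i₀) on K and every g ∈ Γ(K) ∖ 1, W₀ has a 𝟙_-point p with
(p ≫ i₀) ≫ g = p ≫ i₀. Cell, elementary, unpublished as stated; CLOSED MODULO PRINT by ROUTE A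
(director R12; seat p2): `kum4FixedFourfoldHasFixedPointAtKummer_of_tangentFixed' (hFV) (hOg) (hT)`
(Theorems/KummerFixedLocusTransitiveTangent p442732; (H2)-hypothesis form p440544) from THREE PRINT
facts by name — Γ ≅ (ℤ/5)⁴ (`FloccariVaresco2024_autFixingH2H3_equiv_kumType`), Oguiso's 125 reduced
fixed points (`Oguiso2020_fixedPointScheme_translation_generalizedKummerFour`), and the
tangent-dimension form of the smoothness of fixed loci
(`GroupActions.Milne2017_fixedComponent_dim_eq_finrank_tangentFixed`, p439636: Milne AG Thm 13.1,
CGP A.8.10, GW I Thm 6.28; `_holds` leaf p479120) — kernel lemmas p431546/p439733/p437954/p442214.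
ARGUMENT: Fix(g)(ℂ) is one Γ-orbit of odd size normalised by ι₀ ⇒ an ι₀-fixed s* ∈ Fix(g); in
T_{s*}K, T^g = 0 ⇒ dim T^{ι₀} = 4 ⇒ the member of the datum's partition of Fix(ι₀)(ℂ) through s* is
W₀. A top-level crux whose closer discharges stub_Kum4FixedFourfoldHasFixedPointAtKummer (no third
layer). [difficulty: M → provable-now modulo print] (why it might fail: only through a misreading of
print in one of the three named facts — e.g. Oguiso's split stated for t_u but consumed for every g
∈ Γ(K) ∖ 1, or the tangent-dimension fact needing reducedness hypotheses the datum's pieces lack;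
exotic W₀ is void: the typed datum pins i₀(W₀) to a Γ-translate of Floccari's W (REF-AUDIT-19 §1).)
[Floccari2026, BoissiereNieperWisskirchenSarti2011, Oguiso2020CohomologicallyTrivialKummer,
KamenovaMongardiOblomkov2022, HassettTschinkel2013]
State of record at rev 20: Assembly (19139), 19304, 19458 CLOSED proved; L3° (19135) closed modulo
print + L1 TWICE (Route A on X from F125X, of record; and through its filed split: 19505, 19504 and
#7 = (H3) closed modulo print in kernel, (H2) derived p442732); open AS MATHEMATICS: L1's lane-(V)
inputs — LefschetzGenerationHilb5 (computed-certified at n = 5 in all degrees, identification cited)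
and HilbertKummerTransfer (V0); 19267 MODEL_X ASIDE (banked, certified computed clause); the rest
open only on refereed print / by-name conjunctions with conditional closers landed. `closes` and its
five binders unchanged since birth; revs 14–19 rationale-only; rev 20 = lane-(V) items + L1's
registered line.

TWO-LAYER PLAN. L3°'s second layer is FILED and glued by name (#3); L1's lane-(V) inputs are
top-level items name-matched by the stubs of L1's REGISTERED LINE
`Cruxes/LefschetzGenerationKum4/Lines/laneV.lean` (shape (α), J pre-read e04f3ef14233df2b; gen-1
split kept as record, MODEL_X aside). No third layer anywhere (director 2026-08-26T07:34:45Z):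
lemmas attach by `--supports`; (H3) is the top-level crux #7, name-matched by 19504's registered
stub. ALTERNATIVE closing `hc_kum4Type_of_dominated` (Statement §6, Arapura-domination form; no
semisimplicity; HC for all powers of X) stays available.

KILL CRITERIA. Refuted outright by: ONE abelian surface A (full choice of Hilbert schemes, Chern
character operators, even Casimir tensor, Lefschetz class α) and ONE class of H*(A^[5](ℂ);ℂ) outside
the ⟨∪, f_α⟩-span of H^{≤3} (¬LefschetzGenerationHilb5 — e.g. a third engine returning closure
dimension < Σ_k b_k(A^[5]) = 25056; today two engines + the kernel certificate p509361 say = 25056);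
a Kummer fibre where L1-Hilb holds but the range form fails (¬HilbertKummerTransfer: only through a
wrong Λ-transport across Θ); a smooth projective Kum⁴-type X with a Γ(X)-invariant class outside
opCupSpan (¬LefschetzGenerationKum4 — e.g. an independent closure re-run giving dim < 422 in degree
8); or ONE K⁴(A) with a Kummer fixed datum (ι₀, W₀) and g ∈ Γ(K) ∖ 1 such that W₀ contains 0 or ≥ 2
of the 125 fixed points of g (¬Kum4FixedPointCountAtKummer; I1geo dies with it; NONE of them is
exactly ¬#7 and — Route A being kernel-checked — would falsify one of its three named print facts FV
/ Oguiso 3.5–3.6 / tangent fact). Bill A‴ alone dies (fall-back A′, landed) on ONE X of Kum⁴-type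
and g ∈ Γ(X) ∖ 1 with Fix(g) not 125 reduced points: ¬F125X. Forced pivot: O'Grady Thm 1.5 / Voisin
Thm 4.1 only for very general X ⇒ L2 pivots to Floccari–Varesco's M_X route (FloccariVaresco2024 Thm
3.1) or books «H3 CONDITIONAL». Mooted by: HC for Kum⁴-type in print (verify-and-cite memo replaces
the route).

NOT DECOMPOSED YET. Nothing at item level; the route shape admits no third layer. Below the items,
as prover-attached lemmas: under 19504 — (H2) transitivity (DERIVED p442732 + p442214), odd-torsor
lemma p431546, split-sections lemma p431571; under L3° on X — nothing (I1geo ⇐ F125X + FV + tangent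
fact, p446589; closer p451323); under LefschetzGenerationHilb5 — the identification lemmas (engine
operators = typed operators) and the all-n V2 line (registered skeleton, stubs
V2Full/V2Units/V2Polarise; first rung = `fullClosure5`); under HilbertKummerTransfer — F6 (landed
p510750/p511282; remaining fact `Beauville1983_kummerCover_galois`), Künneth, and Θ*Λ_HΘ*⁻¹ = Λ_K ⊗
1 + 1 ⊗ Λ_A (`Literature.Algebra.Lie.dualPartner_unique`); under the seams — S1/S2 discharged in the
line (Fogarty fact in `stub_print`; Casimir theorem); S3: one hyperkähler-Lefschetz fact; under
19267 (aside) — the MODEL_X identification (computed, banked); under #4 / L2′ — dominated classes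
cup-closed and correspondence-stable, Λ_η algebraic from `StandardConjectureBStar`, and the GUARDED
dual-Lefschetz input `HodgeTheory.Andre1996_dualLefschetz_mem_adjoin_lefschetzInvolution`
(DISCHARGED by its `_holds` leaf p468064) — never the unguarded `PolarizationHasDualLefschetz`,
FALSE as stated (`not_polarizationHasDualLefschetz`). Print facts enter the closing theorems as
hypotheses; the only print typed as items are F_Γ, F_Γ′; RULE since rev 5/6: no Literature cite
constant inside any item statement (the lane-(V) items are Theorems-side defs by name).

CHEAPEST FALSIFIER. (H3) and the count on ONE example: A = E × E′, u = (P, 0) with P of order 5, g =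
t_u, ι₀ = −1, W₀ = Floccari's fixed fourfold: list the 125 cosets c + ⟨u⟩ with 5c ∈ ⟨u⟩ (= Fix(t_u),
Oguiso Prop 3.6) and check that exactly one is (−1)-symmetric with {0, ±u, ±2u} on W₀ — exact
arithmetic in (ℤ/25)⁴ (p2's machine check on 19504: 125 orbits, one symmetric); a second symmetric
coset or none kills the count. Lane (V): a third engine for the n = 5 all-degree Fock closure (veng
fock.py and ref g37's Göttsche recomputation agree: 25056, FULL) returning a deficit in some degree
kills LefschetzGenerationHilb5 as typed (d ≤ 8 holds for ALL n in kernel: `allN10_d8`). Third: an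
independent re-run of the L1 closure certificate (kit j237941, j237580: 422 = dim (H⁸)^Γ) returning
< 422 kills LefschetzGenerationKum4.

NUMBERS. b(Kum⁴) = 1,0,7,8,36,64,168,288,1046 (GoettscheSoergel1993); |Γ| = 625, dim (H⁸)^Γ = 422,
non-invariant part 624 = J₄(5) (Foster2024 Rmk 88, GKLR Rmk 33); σ(Kum⁴) = 630; [W₀]² = 6,
[W₀]·[W_x] = 1; |Fix(g)| = 125 on K⁴(A) (Oguiso Prop 3.6) and on every X (F125X), exactly 1 on W₀;
LLV algebra so(4,5); KS(X,L) ~ J³(X)⁴ (OGrady2021KummerTori Thm 1.5). Lane (V): Σ_d b_d(A^[5]) =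
25056, closure FULL in every degree (`fullClosure5`, ×2 + ref); d ≤ 8 full for ALL n (`allN10_d8`);
full closures computed n = 1…7 (j269168: 418176 at n = 7; invariant halves of Kum⁵, Kum⁶: 6684,
26136).

DEFINITION REQUESTS. None new. Lane (V) vocabulary = `Theorems/LaneVDefs.lean` (v0typer g0, sha16
f6262586b08bedfc: LefschetzGenerationHilbAt/Hilb, transferDual, KummerRangeGeneration,
HilbertKummerTransfer, KummerRangeEqInvariants + the kernel glue
`lefschetzGenerationKumAt_kummer_of_hilb`) over
Literature/AlgebraicGeometry/HilbertScheme/{HeisenbergFockSpace, NakajimaOperators,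
ChernCharacterOperators, LefschetzDualTransfer, LefschetzDualHilbertScheme (D3 theorem),
TransferOperator(Super)Commutators, HilbertSchemeTranslationAction (F6)} and
Hyperkaehler/GeneralizedKummerTypeCohomologyTransport (T₄); Γ(X) (`autFixingH2H3`), invariants,
frames, `middleRep`, `gammaAverage`, `dominatedClasses` in Statement.lean;
`opCupSpan`/`degreeClasses`/`invariantClasses` in Literature…Hyperkaehler.LLVGeneration; conjecture
nodes `Kum4FixedPointCountAtKummer`, `Kum4FixedFourfoldMeetsTranslates(AtKummer)`,
`KummerOrbifoldModelKum4` are @[conjecture] defs in Theorems/KummerFixedLocusDefs / L1Defs; F125X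
p451193 (REF-AUDIT-23); closer of record p479571; MODEL_X certificates banked with 19267.

Novelty: Searches (2026-08-25): cell literature seat rounds g0–g2 (HOME/lit/LIT-GRADES-r1.md: 30 graded rows,
lit search / lit read page anchors for every input);
this seat: `lit search --hybrid "Hodge conjecture generalized Kummer type hyperkähler fixed locus
automorphisms"` (10 book hits, none on Kumⁿ, nearest
[corpus:book:kerr2016-recent-advances-hodge-theory-period-domains-algebraic p.298]), `lit vsearch
"<HC for Kummer type via automorphisms trivial on H² and fixed loci>"`
(1 irrelevant hit), `lit galaxy search "Kummer type|generalized Kummer|Kum^4" --star all` (24 rows,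
nearest [galaxy:pdf:659662580] Bottini 2023 thesis on
stable sheaves on HK manifolds — no HC content); in print HC for Kumⁿ-type is known for n = 2
(HassettTschinkel2010) and n = 3 (FloccariVaresco2024,
Floccari2026 via K3 surfaces S_X), open for n = 4.
Nearest prior art found: FloccariVaresco2024 (arXiv:2308.04865, Math. Ann. 391) and Floccari2026
(arXiv:2501.02315, G&T 30) — HC for Kum³-type sixfolds
and for all powers of the associated K3 / disc-1 Weil fourfold; Foster2024 (arXiv:2303.14327) —
Lefschetz standard conjecture for Kumⁿ-type with n+1 prime.
Delta: combine Foster's B(X) at n = 4 with Markman–O'Grady–Voisin's J³ domination on the Γ-INVARIANT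
sub-motive only, certified to be all of it by an
LLV+H³ generation computation, and dispose of the 624 non-invariant middle classes by the fixed
fourfolds' intersection matrix — a new combination one
dimension above the printed frontier.
Claimed grade: new-combin  [refs: 2308.04865, 2501.02315, 2303.14327, book:kerr2016-recent-advances-hodge-theory-period-domains-algebraic, HassettTschinkel2010, FloccariVaresco2024, Floccari2026, Foster2024]

Barriers (technique_class: llv-generation, fixed-locus-cycles, motivic-domination): - technique_class: llv-generation, fixed-locus-cycles, motivic-domination, finite-group-averaging
- Literature.Barriers.HodgeConjecture.MonodromyQuantumGeneration: honoured twice — (a) with G =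
Γ(X): `isFixed_of_mem_seedGenerated` says classes generated from Γ-fixed seeds by Γ-equivariant
operations are Γ-fixed, so H², H³ (Γ acts trivially there) generate AT MOST (H*)^Γ; L1 claims
exactly that, and the 624 non-invariant classes are supplied by fixed-locus cycles (L3°), not by
generation; (b) with G = monodromy of the Kum⁴-type family (the barrier's own reading, technique
class deformation-invariant-correspondences): the route certifies NO class algebraic by generation
from invariant algebraic seeds — L1 is a statement about ALL of (H*)^Γ as a module over cup + Λ (no
algebraicity), and the Hodge classes of a Noether–Lefschetz-special X are reached in L2 through
correspondences with the VARYING abelian fourfold J³(X) (Markman2023GeneralizedKummers Thm 1.4,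
OGrady2021KummerTori Thm 1.5), which are not deformation-invariant correspondences from fixed seeds;
the classes L3° handles (trivial LLV-isotypic part of H⁸, GreenKimLazaRobles2022 Rmk 33) are Hodge
on every deformation, i.e. exactly the generic classes the barrier permits.
- Literature.Barriers.HodgeConjecture.CMHodgeRingNotGeneratedInCodimensionTwo: outside its technique
class (hodge-ring-generated-in-low-codimension, reduction-to-codimension-two-by-products): L1
generates the whole Γ-invariant COHOMOLOGY of a hyperkähler

History (route lifecycle, newest last):
- 2026-08-27T10:20:43Z · rev 22: restated LefschetzGenerationHilb5 (stmt-Ventures-20141) — (rho3) restate 20141 LefschetzGenerationHilb5 -> LefschetzGenerationHilbW 5 (W-form = weakest form the laneV feeder consumes; one IsWZeroModes instance). Ruling (planner-hodge-kum4-plan-g18-0)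
- 2026-08-27T10:29:50Z · rev 23: restated HilbertKummerTransfer (stmt-Ventures-20142) — (C-b) restate 20142 HilbertKummerTransfer to its print-antecedent form (Beauville IHS -> Beauville galois -> V0), ruling director-hodge g7 10:18:51Z/10:25:37Z; (planner-hodge-kum4-plan-g18-0)
- 2026-08-27T10:31:58Z · rev 24: restated KummerRangeEqInvariants (stmt-Ventures-20143) — (C-b) restate 20143 KummerRangeEqInvariants to its print-antecedent form (Beauville galois -> BNWS -> bridge), ruling director-hodge g7 10:18:51Z/10:25:37Z; ant (planner-hodge-kum4-plan-g18-0)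
- 2026-08-27T10:38:55Z · rev 25: restated HilbertKummerTransfer (stmt-Ventures-20313) — REVERT rev 23 (plan g18 error): the (C-b) cite-fact binders (Beauville IHS, Beauville galois) are cite_only prop_defs, NOT walker-exempt => route went staffable (planner-hodge-kum4-plan-g18-0)
- 2026-08-27T10:40:46Z · rev 26: restated KummerRangeEqInvariants (stmt-Ventures-20321) — REVERT rev 24 (plan g18 error): the (C-b) cite-fact binders (Beauville galois, BNWS) are cite_only prop_defs, NOT walker-exempt => staffable NO; back to the bar (planner-hodge-kum4-plan-g18-0)
- 2026-08-27T10:47:08Z · rev 27: restated KummerRangeEqInvariants (stmt-Ventures-20339) — (C-b') restate bridge KummerRangeEqInvariants to the print-antecedent form = EXACT type of p1's landed theorem kummerRangeEqInvariants_of_print (p523665): Beauv (planner-hodge-kum4-plan-g18-0)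
- 2026-08-27T10:50:27Z · rev 28: restated HilbertKummerTransfer (stmt-Ventures-20338) — (C-b') restate V0 HilbertKummerTransfer to the print-antecedent form Beauville IHS -> Beauville galois -> V0 (p2 g11 10:19:16Z antecedent list verbatim, stub_pr (planner-hodge-kum4-plan-g18-0)
- 2026-09-01T16:19:17Z · DORMANT — reconciler: no traction for 5 d (last activity item-evidence-added at 2026-08-27T15:40:30Z); parked, not closed — `ledger route dormant route-Ventures-KummerFix (operator:999:875839)

sub-problem: HodgeKum4 · status: dormant · opened planner-hodge-kum4-plan-g4-0 2026-08-26T00:01:23Z · rev 29 · ledger route-Ventures-KummerFixedLocus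
GENERATED by the gate from the ledger (D-0016/17). Provers cite these decls: `theorem foo : Summit.Ventures.HodgeKum4.Theses.KummerFixedLocus.<Decl> := …` in Summits/Ventures/HodgeKum4/Theorems/<Name>.lean.
-/

namespace Summit.Ventures.HodgeKum4.Theses.KummerFixedLocus

open scoped BigOperators Topology Manifold Classical MeasureTheory ProbabilityTheory Matrix InnerProductSpace ComplexConjugate ContinuousMap
open Filter Set Function TopologicalSpace MeasureTheory

-- H21.Audit: Ventures rung route — no summit Statement decl; the expected conclusion is the closer leaf tagged below
attribute [summit_statement] _root_.Summit.Ventures.HodgeKum4.HC_Kum4Type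

-- earlier LefschetzGenerationHilb5 (stmt-Ventures-20141, replaced 2026-08-27T10:20:43Z -> stmt-Ventures-20306): retired by None — Summit.Ventures.HodgeKum4.LefschetzGenerationHilb 5
/-- item stmt-Ventures-20306 · crux · rank 2 · closed · proved by Summit.Ventures.HodgeKum4.lefschetzGenerationHilb5_holds (prover) · by planner
why it might fail: identifying the certified Fock-engine operators with the instance 𝔊ₖ rests on the W zero-mode identities (L)(G)(W): a sign or 1/k! slip, or the mod-p ⇒ char-0 lift, may break it; all-degree closure is certified at n = 5 only; the all-n V2 line is a plan.
sources: LiQinWang2002, LiQinWang2002W, Lehn1999, Oberdieck2021, arXiv:math/0111047, arXiv:1908.08830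
[crux] L1-Hilb(5), W-FORM (lane (V); Theorems/LaneVDefs.lean §6 `LefschetzGenerationHilbW`; plan g17
ruling (ρ) 2026-08-27T09:33:21Z on the hodge-lit-lqw design point 09:17:37Z; J 10:04:46Z no
objection): for every abelian surface A, every full choice H of Hilbert schemes of points of A,
every instance 𝔊 of the Li–Qin–Wang Chern character interface SATISFYING THE W ZERO-MODE IDENTITIES
`ChernCharacterOperators.IsWZeroModes` (Lehn derivative formula, LQW bracket formula, LQW IMRN 2002
Thm 4.6; such an instance exists by the refereed fact
`LiQinWang2002W_chernCharacter_zeroModes_abelianSurface`, p518057), every EVEN Casimir tensor C of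
the Poincaré pairing and every α ∈ H²(A(ℂ);ℂ) with a dual Lefschetz operator Λ_A: H*(A^[5](ℂ);ℂ) =
⟨H⁰, H¹, H², H³⟩ under cup product and f_α = T(Λ_A)|_{A^[5]} (`transferDual`). This is the WEAKEST
form the lane-(V) feeder consumes (L1 needs L1-Hilb(5) at ONE instance); the ∀-instance form
`LefschetzGenerationHilb 5` is stronger (the interface does not pin 𝔊ₖ for k ≥ 1: the ξ-shift 𝔊″₁(γ)
= 𝔊₁(γ) + 𝔊₀(ξγ) is again an instance) and implies it (`lefschetzGenerationHilbW_of_hilb`), so the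
registered V2 line (Lines/v2.lean: stub_full/stub_units/stub_polari -/
@[route_item "route-Ventures-KummerFixedLocus"]
def LefschetzGenerationHilb5 : Prop :=
  Summit.Ventures.HodgeKum4.LefschetzGenerationHilbW 5

-- `LefschetzGenerationHilb5` holds: proved by `Summit.Ventures.HodgeKum4.lefschetzGenerationHilb5_holds` (its module imports this route file, so no `_holds` link can be stated here).

-- earlier HilbertKummerTransfer (stmt-Ventures-20142, replaced 2026-08-27T10:29:50Z -> stmt-Ventures-20313): retired by None — Summit.Ventures.HodgeKum4.HilbertKummerTransfer
-- earlier HilbertKummerTransfer (stmt-Ventures-20313, replaced 2026-08-27T10:38:55Z -> stmt-Ventures-20338): retired by None — Literature.AlgebraicGeometry.Hyperkaehler.Beauville1983_irreducibleSymplectic_of_kummerType → Literature.AlgebraicGeometry.HilbertScheme.Beauville1983_kummerCover_galois → Summit.Ventures.HodgeKum4.HilbertKummerTransfer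
-- earlier HilbertKummerTransfer (stmt-Ventures-20338, replaced 2026-08-27T10:50:27Z -> stmt-Ventures-20354): retired by None — Summit.Ventures.HodgeKum4.HilbertKummerTransfer
/-- item stmt-Ventures-20354 · crux · rank 3 · closed · proved by Summit.Ventures.HodgeKum4.hilbertKummerTransfer_of_print (prover) · by planner
why it might fail: Θ*Λ_HΘ*⁻¹ = Λ_K ⊗ 1 + 1 ⊗ Λ_A needs unique sl₂-partners on K × A and b₁(K) = 0 (the Beauville-IHS binder); Künneth signs with odd classes of A are delicate — a slip breaks the ⇔ at H¹·H³ terms; the Galois binder must match F6’s deck description verbatim.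
sources: Beauville1983, KapferMenet2018, LooijengaLunts1997, arXiv:1607.03431
[crux] V0 — HILBERT ⟷ KUMMER TRANSFER, CONDITIONAL FORM (ruling (C-b), director-hodge g7
2026-08-27T10:18:51Z; the model of this tree: a refereed print result is a NAMED FACT used as a
hypothesis binder, never smuggled): Beauville1983_irreducibleSymplectic_of_kummerType (b₁(Kⁿ(A)) =
0, used only to split Θ^*ℓ with no H¹(A)⊗H¹(K) term) → Beauville1983_kummerCover_galois (Θ : K × A →
A^[n+1] is the étale Galois quotient by A[n+1]; the translation action itself is a kernel theorem,
F6) → HilbertKummerTransfer — EXACTLY the two antecedents the prover's closing theorem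
`hilbertKummerTransfer_of_print` consumes (p2 g11 10:19:16Z), in stub_print order (conjuncts 2, 6 of
L1's line laneV). UNCONDITIONAL CONTENT as before: V0 — HILBERT ⟷ KUMMER TRANSFER (lane (V);
Theorems/LaneVDefs.lean §4): for every abelian surface A, every n, every Hilbert scheme (H, Ξ) of
n+1 points of A (smooth projective of dimension 2(n+1)), every generalized Kummer fibre j : K ⟶ H
(fibre of alb − alb(x₀) over the unit, K smooth projective of dimension 2n), every ℓ ∈ H²(H) with
dual Lefschetz operator Λ_H and every dual Lefschetz operator Λ_K of θ*ℓ on K: L1-Hilb at (H, Λ_H) ⇔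
L1 in range form at (j, Λ_K) (`KummerRan -/
@[route_item "route-Ventures-KummerFixedLocus"]
def HilbertKummerTransfer : Prop :=
  Literature.AlgebraicGeometry.Hyperkaehler.Beauville1983_irreducibleSymplectic_of_kummerType → Literature.AlgebraicGeometry.HilbertScheme.Beauville1983_kummerCover_galois → Summit.Ventures.HodgeKum4.HilbertKummerTransfer

-- `HilbertKummerTransfer` holds: proved by `Summit.Ventures.HodgeKum4.hilbertKummerTransfer_of_print` (its module imports this route file, so no `_holds` link can be stated here).

/-- item stmt-Ventures-19136 · crux · rank 4 · open · by planner
why it might fail: H²(X) ⊆ correspondence-images from powers of J³X needs KS(X,L) ~ J³(X)⁴ and KSHC(X) for EVERY polarised X (O'Grady Thm 1.5, Voisin Thm 4.1) — if only very general, CM members escape; cup/composition closure of dominated classes must be built in the tree's Gysin formalism.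
sources: Foster2024, Markman2023GeneralizedKummers, Voisin2022FootnotesOGradyMarkman, OGrady2021KummerTori, Floccari2026, FloccariFu2026
[crux] L1 → L2′: assuming LefschetzGenerationKum4, for every smooth projective X of Kum⁴-type every
rational (p,p)-class fixed by Γ(X) is algebraic (h(X)^Γ dominated by / a retract of twisted powers
of J³(X), whose powers satisfy HC). [deps: LefschetzGenerationKum4] [difficulty: L] -/
@[route_item "route-Ventures-KummerFixedLocus"]
def MotivicBookkeepingKum4 : Prop :=
  Summit.Ventures.HodgeKum4.MotivicBookkeepingKum4

/-- item stmt-Ventures-19137 · crux · rank 5 · open · by planner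
why it might fail: only by misreading print: "≤ 624" needs Foster Rmk 88 (non-invariant part of H⁸(Kum⁴) = ONE regular representation minus the trivial one; J₄(5), GKLR Rmk 33); #Γ = 625 = #A[5] transported along deformations (BNWS Cor 3.3(2); HT13 Thm 2.1 + Prop 3.1).
sources: Foster2024, Floccari2026, HassettTschinkel2010, arXiv:1001.4728, arXiv:1208.3750, GreenKimLazaRobles2022
[crux] F_Γ (PRINT INPUT, REFEREED — filed with kind crux only because the gate admits none but
crux-kind binders in `closes` (human ruling 2026-08-16, `glue.non-crux-hypothesis`); NOT a research
target: it closes by transcription of the vendored Literature facts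
`Hyperkaehler.Floccari2026_card_autFixingH2H3_kum4Type` ∧
`Hyperkaehler.Foster2024_translationAction_kum4Type` (p404364/p404745) through seat p2's
definitional bridge): for X smooth projective of Kum⁴-type, |Γ(X)| = 625 and every complement of the
Γ-invariants in H⁸(X;ℂ) has finrank ≤ 624 (Γ-regular span, Foster Rmk 88; Aut₀: BNWS Cor 3.3(2)
[arXiv:1001.4728 p0007:L77–L81: ker(Aut(Kₙ(A)) → O(H²)) ≅ A[n]⋊ℤ/2, n_BNWS = 5 ⇒ 625],
HassettTschinkel2010 Thm 2.1 [arXiv:1004.0046 p0003:L28–L34: Aut° deformation-invariant] + Prop 3.1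
[p0004:L68–L73: trivial on H², extends to every deformation], Oguiso arXiv:1208.3750). [difficulty:
provable-now] -/
@[route_item "route-Ventures-KummerFixedLocus"]
def Kum4TranslationGroup : Prop :=
  Summit.Ventures.HodgeKum4.Kum4TranslationGroup

/-- item stmt-Ventures-19138 · crux · rank 6 · open · by planner
why it might fail: only by misreading print: below degree 8 it is Foster Rmk 88 (i^* : H^k(A^[5]) ↠ H^k(K₄(A)), k < 8, Γ acting trivially upstairs); above degree 8 it needs Γ-equivariant Poincaré duality, standard but not spelled out there — the vendored fact states both halves.
sources: Foster2024, HassettTschinkel2010, FantechiGoettsche2003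
[crux] F_Γ′ (PRINT INPUT, REFEREED — crux-kind for the same gate reason as Kum4TranslationGroup;
closes by transcription of `Hyperkaehler.Foster2024_translationAction_kum4Type`, second conjunct):
Γ(X) acts trivially on Hᵏ(X;ℂ) for every k ≠ 8 (i^*-surjectivity from A^[5] below the middle, Foster
Rmk 88, plus Poincaré duality and deformation invariance). [difficulty: provable-now] -/
@[route_item "route-Ventures-KummerFixedLocus"]
def Kum4TranslationGroupTrivialOffMiddle : Prop :=
  Summit.Ventures.HodgeKum4.Kum4TranslationGroupTrivialOffMiddle

/-- item stmt-Ventures-19134 · crux · rank 2 · SPLIT (gen 1) into KummerOrbifoldModelKum4, KummerTranslationFrameExists, FrameComplementKum4 + glue LefschetzGenerationKum4Glue · direct attempts still welcome (low priority) · by planner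
why it might fail: the certificate is a finite closure computation in ONE ring model (dim (H⁸)^Γ = 422): a slip in the FG sign-modified product, in Λ_ω, or V(2) ∌ c₂ unless H³∪H³ reaches it would leave invariant classes outside the span; single-Λ form needs p1's Λ-uniqueness (p403854).
sources: GreenKimLazaRobles2022, LooijengaLunts1997, FantechiGoettsche2003, FuTianVial2019, Foster2024
retired/moot children: FrameComplementKum4 [replaced: Summit.Ventures.HodgeKum4.FrameComplementKum4]; LefschetzGenerationKum4Glue [replaced: KummerOrbifoldModelKum4 → KummerTranslationFrameExists → FrameComplementKum4 → L]; FrameComplementKum4 [replaced: Literature.AlgebraicGeometry.Hyperkaehler.Floccari2026_card_autFixingH2H3_kum4Ty]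
[crux] for every smooth projective X of Kum⁴-type and every sl₂-triple (L_ℓ, h, Λ) (`IsDualLefschetz
8 ℓ Λ`), the Γ(X)-invariant classes `gammaInvariantClasses X` lie in `opCupSpan Λ (degreeClasses
{0,2,3})`, the smallest cup-closed, Λ-stable subspace containing H⁰, H², H³ (cell lemma L1;
COMPUTED-CERT in the Fantechi–Göttsche model, two independent runs). [difficulty: L] -/
@[route_item "route-Ventures-KummerFixedLocus"]
def LefschetzGenerationKum4 : Prop :=
  Summit.Ventures.HodgeKum4.LefschetzGenerationKum4

-- parent: LefschetzGenerationKum4 · child (gen 1)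
/--     item stmt-Ventures-19267 · aside · rank 201 · open
    parent: LefschetzGenerationKum4 · by planner
    why it might fail: The COMPUTED clause is ours, not print: a basis-ordering or sign slip in the FG discrete-torsion product (colGen5, C₀), or Γ-equivariance only up to an automorphism of (ℤ/5)⁴, breaks φ's multiplicativity on a seed while FTV19 1.4/1.5, FG03 3.10 and deformation invariance stay true.
    sources: FuTianVial2019, FantechiGoettsche2003, arXiv:1001.4728, HassettTschinkel2013
[crux] MODEL_X — the ONE non-print input of L1 (seat p1; director ruling 2026-08-25T23:57:53Z (2) +
ref pre-analysis: PRINT ingredients + COMPUTED identification ⇒ a ROUTE ITEM, @[conjecture]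
Summit-side, never a Literature fact): for every smooth projective X of Kum⁴-type with a Kummer
translation frame `ModelCore (frameInvariants X g)` holds (p1 00:27:01Z, module
Theorems/KummerFixedLocusL1Defs.lean): ∃ φ x₀ with φ injective on the frame-invariant classes, range
φ = C₀ = modelSpace ℂ (the Fantechi–Göttsche / Fu–Tian–Vial orbifold model), φ x₀ = seed ω₀, φ ∘ h =
degOp ∘ φ, seeds with homogeneous preimages of degree ∈ {0,2,3}, and φ(x ⌣ y) = genOp j (φ y)
whenever φ x = seed (j+1), j < 16 (genOp = the computed structure-constant columns colGen5). With
`FrameComplementKum4` (kernel, p2's discharge), the LLV Literature fact and frame existence it gives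
L1 by p1's kernel transport `lefschetzGenerationKum4_of_model`. -/
@[route_item "route-Ventures-KummerFixedLocus"]
def KummerOrbifoldModelKum4 : Prop :=
  Summit.Ventures.HodgeKum4.KummerOrbifoldModelKum4

-- parent: LefschetzGenerationKum4 · child (gen 1)
/--     item stmt-Ventures-19268 · support · rank 202 · open
    parent: LefschetzGenerationKum4 · by planner
    why it might fail: Only by misreading print: deformation-invariance of Aut₀ (HassettTschinkel2013 Thm 2.1) and Γ ≅ (ℤ/(n+1))⁴ (arXiv:1001.4728 Cor 3.3(2)) for n = 4.
    sources: FloccariVaresco2024, Foster2024, arXiv:2308.04865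
[crux] PRINT INPUT (frame existence; Invariants.lean §4): every smooth projective X of Kum⁴-type
carries a Kummer translation frame (Γ(X) ≅ (ℤ/5)⁴ of deformation-induced automorphisms acting
trivially on H² ⊕ H³, with the Kummer involution datum); closes by transcription (p1) from the
vendored facts (BNWS Cor 3.3(2), HassettTschinkel2013 Thm 2.1, FloccariVaresco2024 autFixingH2H3). -/
@[route_item "route-Ventures-KummerFixedLocus"]
def KummerTranslationFrameExists : Prop :=
  Summit.Ventures.HodgeKum4.KummerTranslationFrameExists

-- parent: LefschetzGenerationKum4 · child (gen 1)
/--     item stmt-Ventures-19458 · support · rank 203 · closed · proved by Summit.Ventures.HodgeKum4.frameComplementKum4_holds (prover)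
    parent: LefschetzGenerationKum4 · by planner
    why it might fail: It should not: Maschke over ℂ for the finite group Γ(X) gives the Γ-stable complement N′ = coinvariant kernel, on which h and L_x act by zero because Γ acts trivially on LLV data (Foster2024) — a kernel lemma, not a conjecture.
    sources: Foster2024, GreenKimLazaRobles2022
[support] OURS-KERNEL complement clause stripped out of MODEL_X (p1 00:27:01Z; p2's ≈40-line
discharge from CoinvariantsLLVTrivial / OrbitSpan with N′ := 𝒦_tot): ∀ X g (smooth projective,
Kum⁴-type, frame), ∃ N′, IsCompl (frameInvariants X g) N′ ∧ degreeOperator vanishes on N′ ∧ every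
total Lefschetz operator L_x (x ∈ H²) vanishes on N′. Listed as a child ONLY if it is not yet a
theorem in the tree when the split runs (director g2 00:33:11Z (2b)). -/
@[route_item "route-Ventures-KummerFixedLocus"]
def FrameComplementKum4 : Prop :=
  Summit.Ventures.HodgeKum4.Kum4TranslationGroup → Summit.Ventures.HodgeKum4.Kum4TranslationGroupTrivialOffMiddle → Summit.Ventures.HodgeKum4.FrameComplementKum4

-- `FrameComplementKum4` holds: proved by `Summit.Ventures.HodgeKum4.frameComplementKum4_holds` (its module imports this route file, so no `_holds` link can be stated here).

-- parent: LefschetzGenerationKum4 · glue (gen 1)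
/--     item stmt-Ventures-19304 · support · rank 204 · closed · proved by Summit.Ventures.HodgeKum4.lefschetzGenerationKum4Glue_holds (prover)
    parent: LefschetzGenerationKum4 · GLUE: children ⟹ parent · by planner
MODEL_X → FrameExists → L1: closed by p1's kernel transport theorem
Summit.Ventures.HodgeKum4.lefschetzGenerationKum4_of_model (binders hM : MODEL_X =
KummerOrbifoldModelKum4, hC : FrameComplementKum4 (kernel theorem, or the third child), hF : the
cited Literature fact LooijengaLuntsVerbitsky_llvStructure_kumType (landed p405144), hex :
KummerTranslationFrameExists) — Λ₀ transported through φ is an sl₂-partner of L_{x₀}, C₀-minimality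
gives Inv ≤ llvCupSpan; no rank/dimension count in the kernel -/
@[route_item "route-Ventures-KummerFixedLocus"]
def LefschetzGenerationKum4Glue : Prop :=
  Literature.AlgebraicGeometry.Hyperkaehler.LooijengaLuntsVerbitsky_llvStructure_kumType → Summit.Ventures.HodgeKum4.KummerOrbifoldModelKum4 → Summit.Ventures.HodgeKum4.KummerTranslationFrameExists → Summit.Ventures.HodgeKum4.FrameComplementKum4 → Summit.Ventures.HodgeKum4.LefschetzGenerationKum4

/-- `LefschetzGenerationKum4Glue` holds: proved by `Summit.Ventures.HodgeKum4.lefschetzGenerationKum4Glue_holds`. -/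
theorem LefschetzGenerationKum4Glue_holds : LefschetzGenerationKum4Glue := _root_.Summit.Ventures.HodgeKum4.lefschetzGenerationKum4Glue_holds

/-- item stmt-Ventures-19135 · crux · rank 3 · SPLIT (gen 2) into Kum4TranslationGroupAndL1, Kum4FixedPointCountAtKummer + glue Kum4NonInvariantClassesAlgebraicGlue2 · direct attempts still welcome (low priority) · by planner
why it might fail: rests on I: [W₀]·[W_x] = 1 for x ≠ 0 (Fix⟨ι,t_x⟩ one reduced point) and [W₀]² = 6 on EVERY deformation; a non-reduced fixed point or a sign in the G-signature bookkeeping (σ(X) = 630) drops the Gram rank below 625 and leaves non-invariant classes uncovered.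
sources: Floccari2026, Foster2024, Hirzebruch1969SignatureRamifiedCoverings, HassettTschinkel2010, KamenovaMongardiOblomkov2022, GoettscheSoergel1993
earlier split gen 1: Kum4FGammaAndL1, Kum4FixedFourfoldMeetsTranslates — retired stmt-Ventures-19278, stmt-Ventures-19279, stmt-Ventures-19280
retired/moot children: Kum4FGammaAndL1 [retired: Summit.Ventures.HodgeKum4.Kum4TranslationGroup ∧ Summit.Ventures.HodgeKum4.Lefsc]; Kum4FixedFourfoldMeetsTranslates [retired: Summit.Ventures.HodgeKum4.Kum4FixedFourfoldMeetsTranslates]; Kum4NonInvariantClassesAlgebraicGlue [retired: Kum4FGammaAndL1 → Kum4FixedFourfoldMeetsTranslates → Kum4NonInvariantClassesAlge]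
[crux] L3°: for every smooth projective X of Kum⁴-type the kernel of H⁸(X;ℂ) → Γ(X)-coinvariants
(the span of γ·c − c) consists of algebraic classes — to be proved (seat p2, kernel) from the print
input Kum4TranslationGroup and the cell lemma I =
`Summit.Ventures.HodgeKum4.Kum4FixedFourfoldClasses` (classes of the 625 fixed fourfolds W_x =
t_x(W₀), W₀ = Fix(ι) ≅ Km(A)^[2], with [W₀]² = 6, [W₀]·[W_x] = 1): the 625×625 Gram matrix 5·Id + J
is invertible, so the differences [W_x] − [W₀] span the 624-dimensional non-invariant part.
[difficulty: M] -/
@[route_item "route-Ventures-KummerFixedLocus"]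
def Kum4NonInvariantClassesAlgebraic : Prop :=
  Summit.Ventures.HodgeKum4.Kum4NonInvariantClassesAlgebraic

-- parent: Kum4NonInvariantClassesAlgebraic · child (gen 2)
/--     item stmt-Ventures-19504 · crux · rank 302 · open
    parent: Kum4NonInvariantClassesAlgebraic · by operator
    why it might fail: If some Kummer fixed datum (ι₀, W₀) on K⁴(A) is not Γ-conjugate to (−1, Floccari's W₀) — e.g. W₀ another 4-dimensional ι₀-fixed component on a special A — the one-symmetric-coset count does not apply and W₀ could meet Fix(g) in 0 or 5 points.
    sources: Oguiso2020CohomologicallyTrivialKummer, Floccari2026, BoissiereNieperWisskirchenSarti2011, KamenovaMongardiOblomkov2022, HassettTschinkel2013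
[crux] THE POINT COUNT AT THE KUMMER VARIETIES — the single NON-PRINT residual of the fixed-locus
branch under booking B″ (director-hodge 2026-08-26T06:35:07Z; p2 HOME/p2/I1GEO-SPLIT-OPTION.md
§UPDATE; by name = Summit.Ventures.HodgeKum4.Kum4FixedPointCountAtKummer, module
Theorems/KummerFixedLocusDefs, p429153): for every abelian surface A, every smooth projective K with
Hyperkaehler.IsGeneralizedKummerVarietyOf 4 A K (Albanese-difference fibre of A^[5], Beauville),
every Kummer fixed datum (ι₀, W₀, i₀) on K (Hyperkaehler.IsKummerFixedDatum), every g ∈ Γ(K) ∖ 1,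
every fixed-point scheme j : F ⟶ K of ⟨g⟩ (GroupActions.IsFixedPointScheme, CGP A.8.10(1)) and every
splitting x : Fin 125 → (Spec ℂ ⟶ F) of F into 125 sections (IsColimit (Cofan.mk F x) — the PRINTED
shape, Oguiso NMJ 239 (2020) Prop 3.6 with d = 1:
Hyperkaehler.Oguiso2020_fixedPointScheme_translation_generalizedKummerFour, p427879): EXACTLY ONE of
the points x k ≫ j lies on W₀ (lifts along i₀). A statement about finitely many ℂ-POINTS of explicit
classical varieties; kernel path = D3 (Hilbert-scheme point model of K⁴(A): translations A[5] acting
via the Hilbert universal property; the 125 points are the cosets a + ⟨u⟩) O -/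
@[route_item "route-Ventures-KummerFixedLocus"]
def Kum4FixedPointCountAtKummer : Prop :=
  Summit.Ventures.HodgeKum4.Kum4FixedPointCountAtKummer

-- parent: Kum4NonInvariantClassesAlgebraic · child (gen 2)
/--     item stmt-Ventures-19503 · support · rank 301 · open
    parent: Kum4NonInvariantClassesAlgebraic · by operator
[support] BOOKKEEPING conjunction of the two SHARED top-level items F_Γ (stmt-Ventures-19137, decl
Kum4TranslationGroup) and L1 (stmt-Ventures-19134, decl LefschetzGenerationKum4) — verbatim the
statement of the retired child Kum4FGammaAndL1 (stmt-Ventures-19278); closes by ⟨h19137, h19134⟩ the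
moment both close — NO independent mathematical work; it exists only because split children need
fresh decl names and the glue must be closable by name. Pool provers: do not work this item directly
— work 19137 (print input) or 19134 (MODEL_X chain, seat p1). -/
@[route_item "route-Ventures-KummerFixedLocus"]
def Kum4TranslationGroupAndL1 : Prop :=
  Summit.Ventures.HodgeKum4.Kum4TranslationGroup ∧ Summit.Ventures.HodgeKum4.LefschetzGenerationKum4

-- parent: Kum4NonInvariantClassesAlgebraic · glue (gen 2)
/--     item stmt-Ventures-19505 · support · rank 303 · open
    parent: Kum4NonInvariantClassesAlgebraic · GLUE: children ⟹ parent · by operator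
(F_Γ ∧ L1) → POINT COUNT → L3°: closed MODULO PRINT by p2's kernel theorem
Summit.Ventures.HodgeKum4.kum4NonInvariantClassesAlgebraic_glue_of_pointCount
(Theorems/KummerFixedLocusPointCount.lean; chain: KummerPointAssembly p428849 §D point count +
Oguiso split + |Γ|=625 ⇒ I1geo at K⁴(A); KummerPointTransport p423877 + transport (T) ⇒ crux I ⇒
L3°) via fun ⟨hΓ, hL1⟩ hc => …, whose remaining binders are the REFEREED facts A1 Hirzebruch, A2
Floccari fixed fourfold, Voisin HI/HR, Göttsche–Soergel, GKLR, Foster Γ-action, Floccari |Γ| = 625,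
Fulton transversal point, André's GUARDED dual-Lefschetz fact, the cohomological transport (T)
Hyperkaehler.HassettTschinkel2013_Floccari2026_fixedFourfoldClass_transport_kum4Type (p424699) and
Oguiso's split fixed points
Hyperkaehler.Oguiso2020_fixedPointScheme_translation_generalizedKummerFour (p427879) — the status of
the retired glue 19280 plus two refereed facts. No Literature constant inside any item statement
(rev-5/6 rule, rider r1). -/
@[route_item "route-Ventures-KummerFixedLocus"]
def Kum4NonInvariantClassesAlgebraicGlue2 : Prop :=
  Kum4TranslationGroupAndL1 → Kum4FixedPointCountAtKummer → Kum4NonInvariantClassesAlgebraic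

-- earlier Kum4FixedFourfoldHasFixedPointAtKummer (stmt-Ventures-19595, replaced 2026-08-27T11:07:49Z -> stmt-Ventures-20383): retired by None — Summit.Ventures.HodgeKum4.Kum4FixedFourfoldHasFixedPointAtKummer
/-- item stmt-Ventures-20383 · crux · rank 7 · closed · proved by Summit.Ventures.HodgeKum4.kum4FixedFourfoldHasFixedPointAtKummer_holds (prover) · by planner
why it might fail: Only if some Kummer fixed datum on a special K⁴(A) (A = E×E′, CM) has W₀ an exotic 4-dimensional ι₀-fixed component not Γ-conjugate to Floccari's fourfold W (G&T 2026 Def 4.1), missing every ⟨g⟩-symmetric configuration {b, b±u, b±2u} — BNWS Cor 3.3(2) + Floccari Lem 4.2 [KMO] say no.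
sources: Floccari2026, BoissiereNieperWisskirchenSarti2011, Oguiso2020CohomologicallyTrivialKummer, KamenovaMongardiOblomkov2022, HassettTschinkel2013, arXiv:2501.02315
[crux] (H3) THE ATOM OF RUNG H3, CONDITIONAL FORM (ruling (C-b′), director-hodge g7
2026-08-27T10:18:51Z + width-census plate 10:51:02Z):
FloccariVaresco2024_autFixingH2H3_equiv_kumType (Γ(X) ≅ (ℤ/5)⁴ for Kum⁴-type) →
Oguiso2020_fixedPointScheme_translation_generalizedKummerFour (each g ∈ Γ(K⁴(A)) ∖ 1 has exactly 125
reduced fixed points) → Kum4FixedFourfoldHasFixedPointAtKummer — EXACTLY the two refereed print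
inputs p2 g4's landed closer `kum4FixedFourfoldHasFixedPointAtKummer_of_split`
(Theorems/KummerFixedLocusTangentDischarged.lean; route A, p440544 + tangent discharge) consumes, in
this order; both are item-stated by the held print-input items PrintKumTypeAutFixingH2H3Equiv /
PrintKum4TranslationFixedPoints125, so the item closes BY NAME with a one-line `_holds` wrapper
(probe: plan g18 stamps/H3Close.lean rc 0). UNCONDITIONAL CONTENT as before: THE ATOM OF RUNG H3
(director-hodge 2026-08-26T08:09:37Z R1; booked top-level by ruling (4)(a), in-cone via the
registered skeleton Lines/birth.lean of crux stmt-Ventures-19504, whose stub_hasFixedPoint it is —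
NOT a third layer): on every classical generalized Kummer variety K⁴(A) (A an abelian surface,
Hyperkaehler.IsGeneralizedKumm -/
@[route_item "route-Ventures-KummerFixedLocus"]
def Kum4FixedFourfoldHasFixedPointAtKummer : Prop :=
  Literature.AlgebraicGeometry.Hyperkaehler.FloccariVaresco2024_autFixingH2H3_equiv_kumType → Literature.AlgebraicGeometry.Hyperkaehler.Oguiso2020_fixedPointScheme_translation_generalizedKummerFour → Summit.Ventures.HodgeKum4.Kum4FixedFourfoldHasFixedPointAtKummer

-- `Kum4FixedFourfoldHasFixedPointAtKummer` holds: proved by `Summit.Ventures.HodgeKum4.kum4FixedFourfoldHasFixedPointAtKummer_holds` (its module imports this route file, so no `_holds` link can be stated here).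

/-- item stmt-Ventures-19160 · support · rank 9 · open · by planner
[support] L2′ BY NAME (Bookkeeping.lean:48): the conclusion of L2 = MotivicBookkeepingKum4 := L1 →
L2′ — for every smooth projective X of Kum⁴-type, every rational (p,p)-class fixed by Γ(X) is
algebraic; filed so the deps cone sees L2′ as item-stated (gate5 #15d, director g2 00:40:45Z);
closes the moment L1 and L2 close (modus ponens, p2 one-liner) — never staffed separately; why it
might fail = as L2 (KS(X,L) ~ J³(X)⁴ and KSHC for EVERY polarised X, OGrady Thm 1.5 / Voisin Thm 4.1
— if only very general, CM members escape); sources: Foster2024, Markman2023GeneralizedKummers,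
Voisin2022FootnotesOGradyMarkman, OGrady2021KummerTori, FloccariFu2026 -/
@[route_item "route-Ventures-KummerFixedLocus"]
def InvariantHodgeClassesAlgebraicKum4 : Prop :=
  Summit.Ventures.HodgeKum4.InvariantHodgeClassesAlgebraicKum4

/-- item stmt-Ventures-20342 · support · rank 9 · open · by planner
[support] PRINT INPUT, REFEREED — not a prover target of this cell (closes only by formalising the
source): Beauville 1983 §7 (J. Differential Geom. 18, p. 769 + fn. 2): the morphism Θ : Kⁿ(A) × A →
A^[n+1], (ξ, a) ↦ t_a^{[n+1]} ξ, is the étale Galois quotient by the (n+1)-torsion A[n+1] acting by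
(t_{b⁻¹} × τ_b) (typed `HilbertScheme.Beauville1983_kummerCover_galois`, F6; the translation action
itself is a kernel theorem p510750/p511282; REF-AUDIT-38 §2). Role: leading hypothesis binder of the
lane-(V) items V0 `HilbertKummerTransfer` and bridge `KummerRangeEqInvariants` in their conditional
(C-b) form (director-hodge g7 ruling 2026-08-27T10:18:51Z) and conjunct 6 of `stub_print` of L1’s
line laneV; filed as an ITEM so that the cite-only fact is item-stated (deps-walker exempt; cell
precedent rev 5 → rev 6, director-hodge 2026-08-26T05:11:29Z). SOURCES: Beauville1983,
KapferMenet2018 (Lemma 5.4), arXiv:1607.03431. -/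
@[route_item "route-Ventures-KummerFixedLocus"]
def PrintKummerCoverGalois : Prop :=
  Literature.AlgebraicGeometry.HilbertScheme.Beauville1983_kummerCover_galois

/-- item stmt-Ventures-20350 · support · rank 9 · open · by planner
[support] PRINT INPUT, REFEREED — not a prover target of this cell: Beauville 1983 §7 Prop. 8 + Thm
9 (Kⁿ(A) is irreducible holomorphic symplectic, hence b₁ = 0 for every manifold of
generalized-Kummer deformation type; typed
`Hyperkaehler.Beauville1983_irreducibleSymplectic_of_kummerType`, conjunct 2 of `stub_print` of L1’s
line laneV). Role: leading hypothesis binder of V0 `HilbertKummerTransfer` in its conditional (C-b)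
form (used only for b₁(Kⁿ(A)) = 0: no H¹(A) ⊗ H¹(K) term in Θ^*ℓ, so the dual Lefschetz operator of
A × K is Λ_A ⊗ 1 + 1 ⊗ Λ_K; p2 g11 2026-08-27T10:19:16Z); filed as an ITEM so that the cite-only
fact is item-stated (deps-walker exempt). SOURCES: Beauville1983, Huybrechts1999,
arXiv:alg-geom/9705025. -/
@[route_item "route-Ventures-KummerFixedLocus"]
def PrintKummerTypeIrreducibleSymplectic : Prop :=
  Literature.AlgebraicGeometry.Hyperkaehler.Beauville1983_irreducibleSymplectic_of_kummerType

/-- item stmt-Ventures-20351 · support · rank 9 · open · by planner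
[support] PRINT INPUT, REFEREED — not a prover target of this cell:
Boissière–Nieper-Wißkirchen–Sarti 2011 §3.1 + Cor. 3.3(2) (J. Math. Pures Appl. 95) with Oguiso 2020
Thm 1.2 for H³: for n ≥ 2 the automorphisms of Kⁿ(A) acting trivially on H² ⊕ H³ are exactly the
Kummer translations induced by A[n+1] (typed
`Hyperkaehler.BNWS2011_autFixingH2H3_generalizedKummer`, p520519, REF-AUDIT-40 §4 PASS). Role:
leading hypothesis binder of the bridge `KummerRangeEqInvariants` in its conditional (C-b) form (p1
g4 2026-08-27T10:23:27Z; v0typer g2 10:24:20Z) and conjunct 8 of `stub_print` of L1’s line laneV;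
filed as an ITEM so that the cite-only fact is item-stated (deps-walker exempt). SOURCES:
BoissiereNieperWisskirchenSarti2011, Oguiso2020, arXiv:1001.4728, arXiv:1208.3750. -/
@[route_item "route-Ventures-KummerFixedLocus"]
def PrintKummerAutFixingH2H3 : Prop :=
  Literature.AlgebraicGeometry.Hyperkaehler.BNWS2011_autFixingH2H3_generalizedKummer

-- earlier KummerRangeEqInvariants (stmt-Ventures-20143, replaced 2026-08-27T10:31:58Z -> stmt-Ventures-20321): retired by None — Summit.Ventures.HodgeKum4.KummerRangeEqInvariants
-- earlier KummerRangeEqInvariants (stmt-Ventures-20321, replaced 2026-08-27T10:40:46Z -> stmt-Ventures-20339): retired by None — Literature.AlgebraicGeometry.HilbertScheme.Beauville1983_kummerCover_galois → Literature.AlgebraicGeometry.Hyperkaehler.BNWS2011_autFixingH2H3_generalizedKummer → Summit.Ventures.HodgeKum4.KummerRangeEqInvariants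
-- earlier KummerRangeEqInvariants (stmt-Ventures-20339, replaced 2026-08-27T10:47:08Z -> stmt-Ventures-20352): retired by None — Summit.Ventures.HodgeKum4.KummerRangeEqInvariants
/-- item stmt-Ventures-20352 · support · rank 9 · closed · proved by Summit.Ventures.HodgeKum4.kummerRangeEqInvariants_holds (prover) · by planner
why it might fail: only through the n ≥ 2 hypothesis (at n = 1, A[2] moves H² of the Kummer K3) or a transfer-map normalisation for the non-free action of A[n+1] on K × A; both inputs are refereed print, now explicit binders.
sources: KapferMenet2018, BoissiereNieperWisskirchenSarti2011, arXiv:1001.4728, arXiv:1208.3750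
[support] bridge im θ* = H*(K)^{Γ(K)} (n ≥ 2), CONDITIONAL FORM (ruling (C-b), director-hodge g7
2026-08-27T10:18:51Z): Beauville1983_kummerCover_galois (transfer for the finite Galois quotient Θ)
→ BNWS2011_autFixingH2H3_generalizedKummer (Γ(Kⁿ(A)) = the Kummer translations A[n+1] for n ≥ 2;
Boissière–Nieper-Wißkirchen–Sarti 2011 Cor 3.3(2) + Oguiso 2020, typed p520519) →
KummerRangeEqInvariants — EXACTLY the two antecedents the prover's closing theorem
`kummerRangeEqInvariants_of_print` consumes (p1 g4 10:23:27Z; v0typer g2 10:24:20Z: nothing adds a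
third), in this order. UNCONDITIONAL CONTENT as before: bridge im θ* = H*(K)^{Γ(K)} for n ≥ 2
(Theorems/LaneVDefs.lean §4): for a Kummer fibre j : K ⟶ H of n+1 points of an abelian surface (n ≥
2) the image of θ* = j(ℂ)* is the subspace of Γ(K)-invariant classes, Γ(K) = autFixingH2H3 K.
Inputs: transfer for the finite quotient Θ (Kapfer–Menet Lemma 5.4: im θ* = H*(K)^{A[n+1]}) and
Γ(Kⁿ(A)) = A[n+1] for n ≥ 2 (Boissière–Nieper-Wißkirchen–Sarti 2011 Cor 3.3(2); Oguiso 2020 for H³;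
false at n = 1). SOURCES: KapferMenet2018, BoissiereNieperWisskirchenSarti2011, arXiv:1001.4728,
arXiv:1208.3750. In-cone: name-matched stub `stub_KummerRange -/
@[route_item "route-Ventures-KummerFixedLocus"]
def KummerRangeEqInvariants : Prop :=
  Literature.AlgebraicGeometry.HilbertScheme.Beauville1983_kummerCover_galois → Literature.AlgebraicGeometry.Hyperkaehler.BNWS2011_autFixingH2H3_generalizedKummer → Summit.Ventures.HodgeKum4.KummerRangeEqInvariants

-- `KummerRangeEqInvariants` holds: proved by `Summit.Ventures.HodgeKum4.kummerRangeEqInvariants_holds` (its module imports this route file, so no `_holds` link can be stated here).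

/-- item stmt-Ventures-20381 · support · rank 9 · open · by planner
[support] PRINT INPUT, REFEREED — not a prover target of this cell (closes only by formalising the
source): for n ≥ 2 and X of generalized-Kummer deformation type Kumⁿ, the group Γ(X) of
automorphisms acting trivially on H² ⊕ H³ is ≅ (ℤ/(n+1))⁴ (Boissière–Nieper-Wißkirchen–Sarti 2011
Cor. 3.3(2) for Kⁿ(A) + Hassett–Tschinkel 2013 Thm 2.1 deformation invariance; Floccari–Varesco 2024
§3 ¶1; typed `Hyperkaehler.FloccariVaresco2024_autFixingH2H3_equiv_kumType`, from which
`Floccari2026_card_autFixingH2H3_kum4Type` (|Γ| = 625) is a tree theorem `floccari2026_card`). Role: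
leading hypothesis binder of the (H3) atom `Kum4FixedFourfoldHasFixedPointAtKummer` in its
conditional (C-b′) form — the first of the two print inputs p2 g4’s closer
`kum4FixedFourfoldHasFixedPointAtKummer_of_split` consumes; filed as an ITEM so that the cite-only
fact is item-stated (deps-walker exempt; precedent rev 5 → 6 and rev 27/28). SOURCES:
FloccariVaresco2024, BoissiereNieperWisskirchenSarti2011, HassettTschinkel2013, arXiv:2308.04865,
arXiv:1001.4728. -/
@[route_item "route-Ventures-KummerFixedLocus"]
def PrintKumTypeAutFixingH2H3Equiv : Prop :=
  Literature.AlgebraicGeometry.Hyperkaehler.FloccariVaresco2024_autFixingH2H3_equiv_kumType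

/-- item stmt-Ventures-20382 · support · rank 9 · open · by planner
[support] PRINT INPUT, REFEREED — not a prover target of this cell: Oguiso 2020 (arXiv:1208.3750) §3
Prop. 3.5/3.6 (case n = 5, p = 5, d = 1) with BNWS 2011 Cor. 3.3(2): on a classical generalized
Kummer fourfold-of-points K⁴(A) (A an abelian surface) every g ∈ Γ(K) ∖ 1 has a fixed-point scheme
that is the split coproduct of exactly 125 ℂ-points (typed
`Hyperkaehler.Oguiso2020_fixedPointScheme_translation_generalizedKummerFour`, p431381-era record,
REF-AUDIT of record ref g19 §6–§9). Role: second hypothesis binder of the (H3) atom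
`Kum4FixedFourfoldHasFixedPointAtKummer` in its conditional (C-b′) form (p2 g4’s closer
`kum4FixedFourfoldHasFixedPointAtKummer_of_split hFV hOg`; the tangent-dimension input is a tree
theorem `Milne2017_fixedComponent_dim_eq_finrank_tangentFixed_holds`); filed as an ITEM so that the
cite-only fact is item-stated (deps-walker exempt). SOURCES: Oguiso2020CohomologicallyTrivialKummer,
BoissiereNieperWisskirchenSarti2011, arXiv:1208.3750. -/
@[route_item "route-Ventures-KummerFixedLocus"]
def PrintKum4TranslationFixedPoints125 : Prop :=
  Literature.AlgebraicGeometry.Hyperkaehler.Oguiso2020_fixedPointScheme_translation_generalizedKummerFour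

/-- item stmt-Ventures-19139 · assembly · rank 1 · closed · proved by Summit.Ventures.HodgeKum4.assembly_proof (prover) · by planner
sources: Foster2024, Floccari2026
[assembly] LefschetzGenerationKum4 → Kum4NonInvariantClassesAlgebraic → MotivicBookkeepingKum4 →
Kum4TranslationGroup → Kum4TranslationGroupTrivialOffMiddle → HC_Kum4Type (the rung leaf). -/
@[route_item "route-Ventures-KummerFixedLocus"]
def Assembly : Prop :=
  LefschetzGenerationKum4 → Kum4NonInvariantClassesAlgebraic → MotivicBookkeepingKum4 → Kum4TranslationGroup → Kum4TranslationGroupTrivialOffMiddle → Summit.Ventures.HodgeKum4.HC_Kum4Type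

-- `Assembly` holds: proved by `Summit.Ventures.HodgeKum4.assembly_proof` (its module imports this route file, so no `_holds` link can be stated here).

/-! D-0027 §2.1 — DECIDING THEOREM (planner-authored via `route open/edit --closes-file`; by planner-hodge-kum4-plan-g4-0 2026-08-26T00:01:23Z):
its hypotheses are this route's items and its conclusion the registered leaf `Summit.Ventures.HodgeKum4.HC_Kum4Type` (rung H3, D-0061) (glue_lint), and it elaborates with this file. -/

@[closes "route-Ventures-KummerFixedLocus"] theorem closes (h₁ : LefschetzGenerationKum4) (h₂ : MotivicBookkeepingKum4) (hΓ : Kum4TranslationGroup)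
    (hoff : Kum4TranslationGroupTrivialOffMiddle) (h₃ : Kum4NonInvariantClassesAlgebraic) :
    Summit.Ventures.HodgeKum4.HC_Kum4Type :=
  (show Assembly from fun a b c d e => Summit.Ventures.HodgeKum4.hc_kum4Type_of_inputs a c d e b) h₁ h₃ h₂ hΓ hoff

end Summit.Ventures.HodgeKum4.Theses.KummerFixedLocus
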